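import Summits.HubbardSuperconductivity.HubbardSuperconductivity.Theorems.TwSeededEnsembleEquivalenceR.Negative.HalfFilling
import Summits.HubbardSuperconductivity.HubbardSuperconductivity.Theorems.TwSeededEnsembleEquivalenceR.Negative.LevelCount
import Literature.MathematicalPhysics.QuantumLattice.FermionOperatorsProofs
import Literature.MathematicalPhysics.QuantumLattice.HubbardWave0Proofs

/-!
# Crux `TwSeededEnsembleEquivalenceR` (stmt-HubbardSuperconductivity-15581) — the doping CEILING is load-bearing too:
# the repaired crux's BODY is FALSE at the empty band (`δ = 1`), by a COLD kill

Negative-side support lemmas (refuter, cdisprove gen 1), sorry-free and definition-free. Companion of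
`Negative/HalfFilling.lean` (`δ = 0`). At `δ = 1` the crux's sector is the vacuum line (`N_L = 0`, `e_L = 0`:
`minEnergyOn_seededCan_vacuumSector_nonneg`), so the defect functional is the PRESSURE, and for every slope `μ` of a
window `⊂ (−4, 0)` the pressure of the weakly repulsive seeded torus is bounded below by the free FILLING ENERGY of the
levels within `a = min 2 ((μ₁+4)/2)` of the band bottom: `D_L(β,μ) ≥ −E₀(Hgc(U,μ,g))/L² ≥ (μ₁+4)(a/(16π))² − U`
(level count of `LevelCount.lean` at `ν = −4`; `Z ≥ e^{−βE₀}`). This is a T = 0 HULL GAP per site that is NOT exponentially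
small in `1/U` — exactly the kill shape of the crux's Template C_R (`Cruxes/…R/Disproof.lean`, `r_false_of_coldHullGap`) —
and the kill is executed at the COLD end (`β` as large as the allowance requires, opened by `U → 0⁺`):

* `twSeededEnsembleEquivalenceR_body_false_at_emptyBand` — the body of `TwSeededEnsembleEquivalenceR` with `δ := 1` is
  FALSE. So the body holds at most for `δ ∈ (0, 1)`: both window constraints `−4 < μ₁` / `μ₂ < 0` are matched to a
  non-empty / non-half-filled band, and the kill pipeline of Template C_R is road-tested end to end on a genuine
  (non-exponentially-small) hull gap. Physically trivial (an empty band has chemical potential `≤ −4`); recorded so that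
  no line wastes a stub on "uniformity in δ up to the edges".
-/

set_option linter.dupNamespace false

namespace Summit.HubbardSuperconductivity.HubbardSuperconductivity.Theorems.TwSeededEnsembleEquivalenceR.Negative

open Matrix Literature.MathematicalPhysics.QuantumLattice Literature.Probability.LatticeModels
open Summit.HubbardSuperconductivity.HubbardSuperconductivity.Theorems.TwSeededEnsembleEquivalence.Negative
open scoped ComplexOrder Matrix.Norms.L2Operator

noncomputable section

/-! ### The vacuum sector carries zero seeded energy -/

/-- A `0`-particle vector is its vacuum component times the vacuum. [folklore] -/
theorem eq_smul_vacuum_of_isNParticle_zero {ι : Type*} [LinearOrder ι] {ψ : Fock ι} (h : IsNParticle 0 ψ) :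
    ψ = ψ ∅ • (vacuum : Fock ι) := by
  funext s
  by_cases hs : s = ∅
  · subst hs
    rw [Pi.smul_apply, vacuum, Pi.single_eq_same, smul_eq_mul, mul_one]
  · have : ψ s = 0 := h s (fun hc => hs (Finset.card_eq_zero.mp hc))
    rw [Pi.smul_apply, vacuum, Pi.single_eq_of_ne hs, smul_zero]
    exact this

/-- The local pair operator annihilates the vacuum. [folklore] -/
theorem localPair_mulVec_vacuum_eq_zero (L : ℕ) [NeZero L] (x : TorusSite 2 L) :
    localPair dWaveFormFactor L x *ᵥ (vacuum : Fock (Orb (FermionTorus 2 L))) = 0 := by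
  have han : ∀ (A : Matrix (Finset (Orb (FermionTorus 2 L))) (Finset (Orb (FermionTorus 2 L))) ℂ)
      (i : Orb (FermionTorus 2 L)), (A * annihilation i) *ᵥ (vacuum : Fock (Orb (FermionTorus 2 L))) = 0 :=
    fun A i => by rw [← mulVec_mulVec, annihilation_mulVec_vacuum_holds, mulVec_zero]
  simp only [localPair, Matrix.sum_mulVec, Matrix.smul_mulVec, Matrix.sub_mulVec, han, sub_zero, smul_zero,
    Finset.sum_const_zero]

/-- The pair field annihilates the vacuum. [folklore] -/
theorem pairField_mulVec_vacuum_eq_zero (L : ℕ) [NeZero L] :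
    pairField dWaveFormFactor L *ᵥ (vacuum : Fock (Orb (FermionTorus 2 L))) = 0 := by
  rw [pairField, Matrix.sum_mulVec]
  exact Finset.sum_eq_zero fun x _ => localPair_mulVec_vacuum_eq_zero L x

/-- The seeded canonical Hamiltonian annihilates the vacuum. [folklore] -/
theorem seededCan_mulVec_vacuum (L : ℕ) [NeZero L] (U g : ℝ) :
    (hubbardTorus 2 L 1 U - ((g / (L : ℝ) ^ 2 : ℝ) : ℂ) •
        ((pairField dWaveFormFactor L)ᴴ * pairField dWaveFormFactor L)) *ᵥ
      (vacuum : Fock (Orb (FermionTorus 2 L))) = 0 := by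
  rw [sub_mulVec, smul_mulVec, ← mulVec_mulVec, pairField_mulVec_vacuum_eq_zero, mulVec_zero, smul_zero,
    sub_zero]
  exact hamiltonian_mulVec_vacuum (fermionTorusGraph 2 L) 1 U

/-- **Zero-particle sectors carry zero seeded energy**: `0 ≤ minE(Hcan(U,g), K)` for every `K ≠ ⊥` of `0`-particle
vectors (in fact `= 0`). [folklore] -/
theorem minEnergyOn_seededCan_vacuumSector_nonneg (L : ℕ) [NeZero L] (U g : ℝ)
    (K : Submodule ℂ (Fock (Orb (FermionTorus 2 L)))) (hK : K ≠ ⊥) (hKN : ∀ ψ ∈ K, IsNParticle 0 ψ) :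
    0 ≤ (hubbardTorus 2 L 1 U - ((g / (L : ℝ) ^ 2 : ℝ) : ℂ) •
        ((pairField dWaveFormFactor L)ᴴ * pairField dWaveFormFactor L)).minEnergyOn K := by
  obtain ⟨v, hvK, hv0⟩ := (Submodule.ne_bot_iff K).1 hK
  obtain ⟨c, -, hc1⟩ := exists_smul_unit hv0
  refine le_csInf ⟨_, c • v, K.smul_mem c hvK, hc1, rfl⟩ ?_
  rintro E ⟨φ, hφK, hφ1, rfl⟩
  rw [eq_smul_vacuum_of_isNParticle_zero (hKN φ hφK), mulVec_smul, seededCan_mulVec_vacuum, smul_zero,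
    dotProduct_zero, Complex.zero_re]

/-! ### The free filling energy at the band bottom -/

/-- **Filling energy near the band bottom.** For `L ≥ 3`, `μ = −4 + m` with `0 ≤ a ≤ m/2`:
`m·#{k : |ε_L(k) + 4| ≤ a} ≤ −E₀(K⁰_μ)` (each such level lies `≥ m − a ≥ m/2` below `μ` and is filled twice). [folklore] -/
theorem mul_card_le_neg_groundEnergy_free (L : ℕ) [NeZero L] (hL : 3 ≤ L) {m a μ : ℝ} (hμ : μ = -4 + m)
    (ham : a ≤ m / 2) :
    m * ((Finset.univ.filter fun k : TorusSite 2 L => |torusBand L k - (-4)| ≤ a).card : ℝ) ≤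
      -(hubbardTorusWith 2 L 1 0 μ).groundEnergy := by
  classical
  rw [groundEnergy_hubbardTorusWith_zero hL μ]
  have hpt : ∀ k : TorusSite 2 L, min (torusBand L k - μ) 0 ≤
      -(m / 2) * (if |torusBand L k - (-4)| ≤ a then 1 else 0) := by
    intro k
    split_ifs with h
    · rw [abs_le] at h
      have : torusBand L k - μ ≤ -(m / 2) := by rw [hμ]; linarith [h.2]
      rw [mul_one]
      exact (min_le_left _ _).trans this
    · rw [mul_zero]; exact min_le_right _ _
  have hsum := Finset.sum_le_sum fun k (_ : k ∈ Finset.univ) => hpt k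
  rw [← Finset.mul_sum, Finset.sum_boole] at hsum
  linarith

/-! ### Template I′ — the kill at the empty band -/

/-- **The body of the repaired crux at `δ = 1` (empty band) is FALSE.** Against any window `[μ₁,μ₂] ⊂ (−4,0)` and any
`(a, K', U₀)` the disprover plays `m := μ₁ + 4 > 0`, `w := min 2 (m/2)`, `κ₀ := m (w/(16π))²`, `β := max 1 (8 log 4/κ₀)`,
`U := min U₀ (min (κ₀/4) (min (1/(10K')) (a/(log β + 1))))` (so `β ≤ e^{a/U}`), `g := K'U`, `ε := κ₀/8`, `L ≥ 16π/w`: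
then `D_L = 0 + p_L ≥ −E₀(Hgc)/L² ≥ κ₀ − U ≥ 3κ₀/4 > log 4/β + ε`. [folklore] -/
theorem twSeededEnsembleEquivalenceR_body_false_at_emptyBand :
    ¬ (∃ μ₁ μ₂ : ℝ, -4 < μ₁ ∧ μ₁ ≤ μ₂ ∧ μ₂ < 0 ∧
        ∃ a K' U₀ : ℝ, 0 < a ∧ 0 < K' ∧ 0 < U₀ ∧ ∀ U ∈ Set.Ioc (0 : ℝ) U₀, ∀ g ∈ Set.Icc (K' * U) (1 / 10),
          ∀ β : ℝ, 1 ≤ β → β ≤ Real.exp (a / U) →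
            ∃ μ ∈ Set.Icc μ₁ μ₂, ∀ ε : ℝ, 0 < ε → ∃ L₀ : ℕ, ∀ (L : ℕ) [NeZero L], L₀ ≤ L →
              (((hubbardTorus 2 L 1 U - ((g / (L : ℝ) ^ 2 : ℝ) : ℂ) •
                ((pairField dWaveFormFactor L)ᴴ * pairField dWaveFormFactor L))).minEnergyOn
                  (szSector (Λ := FermionTorus 2 L) (2 * ⌊(1 - (1 : ℝ)) * (L : ℝ) ^ 2 / 2⌋₊) 0) / (L : ℝ) ^ 2) +
                (Real.log (Matrix.partitionFn β (hubbardTorusWith 2 L 1 U μ - ((g / (L : ℝ) ^ 2 : ℝ) : ℂ) •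
                  ((pairField dWaveFormFactor L)ᴴ * pairField dWaveFormFactor L))).re / (β * (L : ℝ) ^ 2)) -
                μ * ((2 * ⌊(1 - (1 : ℝ)) * (L : ℝ) ^ 2 / 2⌋₊) : ℝ) / (L : ℝ) ^ 2 ≤ Real.log 4 / β + ε) := by
  rintro ⟨μ₁, μ₂, hμ₁, hμ₁₂, hμ₂, a, K', U₀, ha, hK', hU₀, H⟩
  have hπ := Real.pi_pos
  -- the margin
  set m : ℝ := μ₁ + 4 with hmdef
  have hm : 0 < m := by rw [hmdef]; linarith
  set w : ℝ := min 2 (m / 2) with hwdef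
  have hw0 : 0 < w := lt_min (by norm_num) (by positivity)
  have hw2 : w ≤ 2 := min_le_left _ _
  have hwm : w ≤ m / 2 := min_le_right _ _
  set κ₀ : ℝ := m * (w / (16 * Real.pi)) ^ 2 with hκ₀
  have hκ₀pos : 0 < κ₀ := by positivity
  -- the witness temperature
  set β : ℝ := max 1 (8 * Real.log 4 / κ₀) with hβdef
  have hβ1 : 1 ≤ β := le_max_left _ _
  have hβpos : 0 < β := lt_of_lt_of_le one_pos hβ1
  have hlog4 : 0 < Real.log 4 := Real.log_pos (by norm_num)
  have hslack : Real.log 4 / β ≤ κ₀ / 8 := by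
    rw [div_le_iff₀ hβpos]
    have : 8 * Real.log 4 / κ₀ ≤ β := le_max_right _ _
    rw [div_le_iff₀ hκ₀pos] at this
    linarith
  have hlog : 0 ≤ Real.log β := Real.log_nonneg hβ1
  have hlog1 : 0 < Real.log β + 1 := by linarith
  -- the witness coupling and seed
  set U : ℝ := min U₀ (min (κ₀ / 4) (min (1 / (10 * K')) (a / (Real.log β + 1)))) with hUdef
  have hUpos : 0 < U := by
    rw [hUdef]
    exact lt_min hU₀ (lt_min (by positivity) (lt_min (by positivity) (by positivity)))
  have hUU₀ : U ≤ U₀ := min_le_left _ _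
  have hUκ : U ≤ κ₀ / 4 := (min_le_right _ _).trans (min_le_left _ _)
  have hUK : U ≤ 1 / (10 * K') := (min_le_right _ _).trans ((min_le_right _ _).trans (min_le_left _ _))
  have hUa : U ≤ a / (Real.log β + 1) := (min_le_right _ _).trans ((min_le_right _ _).trans (min_le_right _ _))
  have hUm : U ∈ Set.Ioc (0 : ℝ) U₀ := ⟨hUpos, hUU₀⟩
  have hgm : K' * U ∈ Set.Icc (K' * U) (1 / 10) := by
    refine ⟨le_rfl, ?_⟩
    have h := mul_le_mul_of_nonneg_left hUK hK'.le
    have e : K' * (1 / (10 * K')) = 1 / 10 := by field_simp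
    linarith [h, e.le, e.ge]
  have hβexp : β ≤ Real.exp (a / U) := by
    have h1 : Real.log β ≤ a / U := by
      rw [le_div_iff₀ hUpos]
      have h2 : U * (Real.log β + 1) ≤ a := by
        have := mul_le_mul_of_nonneg_right hUa hlog1.le
        rwa [div_mul_cancel₀ _ hlog1.ne'] at this
      nlinarith
    calc β = Real.exp (Real.log β) := (Real.exp_log hβpos).symm
      _ ≤ Real.exp (a / U) := Real.exp_le_exp.2 h1
  obtain ⟨μ, hμm, hμ⟩ := H U hUm (K' * U) hgm β hβ1 hβexp
  obtain ⟨L₀, hL₀⟩ := hμ (κ₀ / 8) (by positivity)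
  -- a side `L ≥ max(L₀, 3, 16π/w)`
  obtain ⟨L₁, hL₁⟩ := exists_nat_gt (16 * Real.pi / w)
  set L : ℕ := max L₀ (max 3 L₁) with hLdef
  haveI : NeZero L := ⟨by omega⟩
  have hL3 : 3 ≤ L := (le_max_left _ _).trans (le_max_right _ _)
  have hL1 : (L₁ : ℝ) ≤ L := by
    have : L₁ ≤ L := (le_max_right _ _).trans (le_max_right _ _)
    exact_mod_cast this
  have hLpos : (0 : ℝ) < (L : ℝ) ^ 2 := cast_sq_pos_of_neZero L
  have hinst := hL₀ L (le_max_left _ _)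
  -- the sector at δ = 1 is the vacuum line
  have hN : 2 * ⌊(1 - (1 : ℝ)) * (L : ℝ) ^ 2 / 2⌋₊ = 0 := by simp
  have hNr : (2 : ℝ) * (⌊(1 - (1 : ℝ)) * (L : ℝ) ^ 2 / 2⌋₊ : ℝ) = 0 := by simp
  rw [hNr, mul_zero, zero_div, sub_zero] at hinst
  have hKne := szSector_floor_ne_bot L (δ := 1) zero_le_one
  have hKN : ∀ ψ ∈ szSector (Λ := FermionTorus 2 L) (2 * ⌊(1 - (1 : ℝ)) * (L : ℝ) ^ 2 / 2⌋₊) 0, IsNParticle 0 ψ :=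
    fun ψ hψ => by
      have h := ((mem_szSector_iff _ _ ψ).1 hψ).1
      rwa [hN] at h
  have hA := minEnergyOn_seededCan_vacuumSector_nonneg L U (K' * U) _ hKne hKN
  -- the pressure from the grand-canonical ground energy
  have hZ := neg_mul_groundEnergy_le_log_partitionFn (isHermitian_seededGC L U μ (K' * U)) β
  have hE1 := groundEnergy_seededGC_le_free_add L hUpos.le (mul_nonneg hK'.le hUpos.le) μ (g := K' * U)
  -- the free filling energy: μ = −4 + m' with m' = μ + 4 ≥ m, a := w ≤ m/2 ≤ m'/2
  have hm' : w ≤ (μ + 4) / 2 := by linarith [hμm.1]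
  have hE2 := mul_card_le_neg_groundEnergy_free L hL3 (m := μ + 4) (a := w) (μ := μ) (by ring) hm'
  have hLw : 1 ≤ w * L / (16 * Real.pi) := by
    rw [le_div_iff₀ (by positivity)]
    have h1 : 16 * Real.pi / w < L := hL₁.trans_le hL1
    rw [div_lt_iff₀ hw0] at h1
    linarith
  have hcnt := sq_le_card_filter_abs_torusBand_sub_le (L := L) (ν := -4) (by norm_num) hw0 hw2 hLw
  -- assemble: −E₀(Hgc) ≥ (μ+4)·count − U L² ≥ m (wL/16π)² − U L² = (κ₀ − U) L²
  set E := (hubbardTorusWith 2 L 1 U μ - ((K' * U / (L : ℝ) ^ 2 : ℝ) : ℂ) •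
      ((pairField dWaveFormFactor L)ᴴ * pairField dWaveFormFactor L)).groundEnergy with hE
  set Z := Real.log ((hubbardTorusWith 2 L 1 U μ - ((K' * U / (L : ℝ) ^ 2 : ℝ) : ℂ) •
      ((pairField dWaveFormFactor L)ᴴ * pairField dWaveFormFactor L)).partitionFn β).re with hZdef
  set A := (hubbardTorus 2 L 1 U - ((K' * U / (L : ℝ) ^ 2 : ℝ) : ℂ) •
      ((pairField dWaveFormFactor L)ᴴ * pairField dWaveFormFactor L)).minEnergyOn
      (szSector (Λ := FermionTorus 2 L) (2 * ⌊(1 - (1 : ℝ)) * (L : ℝ) ^ 2 / 2⌋₊) 0) with hAdef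
  have hcount : κ₀ * (L : ℝ) ^ 2 ≤ (μ + 4) *
      ((Finset.univ.filter fun k : TorusSite 2 L => |torusBand L k - (-4)| ≤ w).card : ℝ) := by
    have h1 : m * (w * L / (16 * Real.pi)) ^ 2 ≤ (μ + 4) * (w * L / (16 * Real.pi)) ^ 2 :=
      mul_le_mul_of_nonneg_right (by linarith [hμm.1]) (sq_nonneg _)
    have h2 : (μ + 4) * (w * L / (16 * Real.pi)) ^ 2 ≤ (μ + 4) *
        ((Finset.univ.filter fun k : TorusSite 2 L => |torusBand L k - (-4)| ≤ w).card : ℝ) :=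
      mul_le_mul_of_nonneg_left hcnt (by linarith [hμm.1])
    have e : κ₀ * (L : ℝ) ^ 2 = m * (w * L / (16 * Real.pi)) ^ 2 := by rw [hκ₀]; ring
    rw [e]; exact h1.trans h2
  have hEneg : κ₀ * (L : ℝ) ^ 2 - U * (L : ℝ) ^ 2 ≤ -E := by linarith [hE1, hE2, hcount]
  have hZ' : κ₀ - U ≤ Z / (β * (L : ℝ) ^ 2) := by
    rw [le_div_iff₀ (mul_pos hβpos hLpos)]
    have h5 := mul_le_mul_of_nonneg_left hEneg hβpos.le
    rw [mul_neg] at h5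
    have e2 : (κ₀ - U) * (β * (L : ℝ) ^ 2) = β * (κ₀ * (L : ℝ) ^ 2 - U * (L : ℝ) ^ 2) := by ring
    rw [e2]
    linarith [h5, hZ]
  have hA' : 0 ≤ A / (L : ℝ) ^ 2 := div_nonneg hA hLpos.le
  have hinst' : A / (L : ℝ) ^ 2 + Z / (β * (L : ℝ) ^ 2) ≤ Real.log 4 / β + κ₀ / 8 := hinst
  linarith

end

end Summit.HubbardSuperconductivity.HubbardSuperconductivity.Theorems.TwSeededEnsembleEquivalenceR.Negative
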